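import Summits.NavierStokesRegularity.NavierStokesRegularity.Theses.AxisymmetricExtremality
import Summits.NavierStokesRegularity.NavierStokesRegularity.Theorems.AxisymmetricExtremalityAxisymmetricKatoGlobalStubSereginLogSwirlOriginCutoffDivCurlSecondOrder
import Literature.Analysis.FluidPDE.AxisymSmallSwirlL4
import HarnessLib

/-!
# Seregin 2022, §2 Step 4: `curl v̄ = ω_θ e_θ` for the smooth poloidal part and the second
# cut-off elliptic bound in its printed form `… + c‖curl (ω_θζe_θ)‖₂` — crux stmt-NavierStokesRegularity-15453 (`AxisymmetricExtremality.AxisymmetricKatoGlobal`), line registered, support for stub `stub_sereginLogSwirlOrigin`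

Support file (`--supports stmt-NavierStokesRegularity-15453`; theorems only, everything proved)
toward the registered stub `stub_sereginLogSwirlOrigin` = the named fact
`Literature.Analysis.FluidPDE.seregin2022_logSwirl_regularAtOrigin` (G. Seregin, J. Math. Fluid
Mech. 24 (2022), Paper 27 = arXiv:2201.00153, §2); third of the cut-off `div`–`curl` files
(`…CutoffDivCurl.lean`: first bound; `…CutoffDivCurlSecondOrder.lean`: second bound for a general
field `w`, `‖∇²(ζw)‖ ≲ ‖curl (ζ curl w)‖ + …`). Seregin's elliptic system for the poloidal part
`v̄ = v_r e_r + v₃ e₃` is "`div v̄ = 0`, `curl v̄ = ω_θ e_θ` in `𝒞`" (§1, (ellipticsystem)), and the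
second Step-4 bound reads `‖∇²(η³v̄)‖₂ ≤ c‖|∇η³||∇v̄|‖₂ + c‖|∇²η³||v̄|‖₂ + c‖curl (ω_θη³e_θ)‖₂`
(arXiv p. 7). In the tree the smooth poloidal part of an axisymmetric `u` is Wei's
`b = u − (u_θ/r) J` (`angVelQuot u = u_θ/r`, `J = rotGen`, `(u_θ/r)J = u_θ e_θ`), with
`div b = div u` and `‖curl b‖² = r²Γ²` (`Wei2016PoloidalCurl`, `Γ = angVortQuot u = ω_θ/r`). Here:

* `curl_sub_angVelQuot_smul_rotGen` — **`curl b = Γ J` everywhere** (`= ω_θ e_θ`) for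
  axisymmetric `u ∈ C⁴(ℝ³)`: the structure theorem `curl b = f J` for axisymmetric swirl-free
  fields (`curl_eq_hadamardQuotFst_smul_rotGen`) and `⟪curl b, J⟫ = ⟪curl u, J⟫ = r²Γ`;
* `lintegral_sum_frobeniusNormSq_fderiv_fderiv_smul_poloidal_le` (registered sub-goal;
  hypothesis form `…_le'`) — for `u ∈ C⁵(ℝ³)` axisymmetric and divergence free on an open
  `U ⊇ tsupport ζ`, `ζ ∈ C³_c`:
  `∫ ∑ₖ |D∂ₖ(ζb)|²_F ≤ 2∫ ‖curl ((ζΓ)J)‖² + (2‖curlCLM‖⁴ + 3) ∫ (‖Dζ‖‖Db‖ + ‖D²ζ‖‖b‖)²` — the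
  printed second bound with the printed right-hand side `curl (ω_θζ e_θ) = curl ((ζΓ)J)`
  (the sibling's `lintegral_sum_frobeniusNormSq_fderiv_fderiv_smul_le` with `w = b`);
* `curl_smul_rotGen_apply_two`, `norm_curl_smul_rotGen_sq`, `norm_curl_smul_rotGen_sq_le` —
  Seregin's `curl (ω_θζe_θ) = −(ω_θζ),₃ e_r + ((ω_θζ),_r + Γζ) e₃` in Cartesian form:
  `‖curl (gJ)‖² = (x₀² + x₁²)(∂₂g)² + (2g + x₀∂₀g + x₁∂₁g)² ≤ 8g² + 2r² ∑ᵢ(∂ᵢg)²` (`g = ζΓ`), which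
  puts the right-hand side under the Step-3 quantities `‖η³Γ‖₂`, `‖η³∇Γ‖₂`.

## Mathlib / tree search

Tree: `curl_eq_hadamardQuotFst_smul_rotGen` (`AxisymNoSwirlVorticity`),
`Wei2016.isAxisymmetric/hasNoSwirl/divergence_sub_angVelQuot_smul_rotGen`,
`Wei2016.norm_curl_sub_angVelQuot_smul_rotGen_sq` (only the norm; the vector identity below is
its un-squared form), `inner_curl_smul_rotGen_rotGen`, `IsAxisymmetric.cylRadius_sq_mul_angVortQuot`,
`contDiff_angVelQuot`, `rotGenL`, `curl_smul_rotGenL_apply_zero/one`, `fderiv_smul_rotGenL_apply`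
(`AxisymSmallSwirlL4`). `lean search 'curl_sub_angVelQuot_smul_rotGen |norm_curl_smul_rotGen_sq '`:
no matches (2026-08-17).

## References

* G. Seregin, J. Math. Fluid Mech. 24 (2022), Paper No. 27 = arXiv:2201.00153, §1
  (ellipticsystem) and §2 Step 4 (arXiv p. 7, second "classical bound"). [`Seregin2022LocalAxisym`]
* D. Wei, arXiv:1508.03318 / Z. Lei, Q. S. Zhang, arXiv:1505.02628 §3 (the poloidal field `b`).
  [`Wei2016`, `LeiZhang2017`]
-/

noncomputable section

open Set MeasureTheory Filter Topology Function
open scoped ENNReal RealInnerProductSpace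
open Literature.Analysis.FluidPDE

-- `<Problem> = <Summit>` duplicates a namespace component by design (lakefile sets the same option).
set_option linter.dupNamespace false

namespace Summit.NavierStokesRegularity.NavierStokesRegularity.Theorems.AxisymmetricKatoGlobal.EulerScaling

section Poloidal

variable {ζ : EuclideanSpace ℝ (Fin 3) → ℝ} {U : Set (EuclideanSpace ℝ (Fin 3))}

/-- **`curl b = Γ J` everywhere** for the smooth poloidal field `b = u − (u_θ/r) J` of an
axisymmetric `u ∈ C⁴(ℝ³)` (`Γ = angVortQuot u = ω_θ/r`, `J = rotGen`; i.e. `curl v̄ = ω_θ e_θ`):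
the tree's structure theorem `curl b = f J` for axisymmetric swirl-free fields
(`curl_eq_hadamardQuotFst_smul_rotGen`) and `⟪curl b, J⟫ = ⟪curl u, J⟫ = r²Γ`. [cite: Seregin2022LocalAxisym, §1 display (ellipticsystem)] -/
theorem curl_sub_angVelQuot_smul_rotGen {u : EuclideanSpace ℝ (Fin 3) → EuclideanSpace ℝ (Fin 3)}
    (hax : IsAxisymmetric u) (hu : ContDiff ℝ 4 u) (x : EuclideanSpace ℝ (Fin 3)) :
    curl (fun y => u y - angVelQuot u y • rotGen y) x = angVortQuot u x • rotGen x := by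
  -- adapted from `Wei2016.norm_curl_sub_angVelQuot_smul_rotGen_sq`
  have hu2 : ContDiff ℝ 2 u := hu.of_le (by norm_num)
  have hu3 : ContDiff ℝ 3 u := hu.of_le (by norm_num)
  have hud : Differentiable ℝ u := hu.differentiable (by norm_num)
  have hΦ2 : ContDiff ℝ 2 (angVelQuot u) := contDiff_angVelQuot (n := 2) hu
  have hJ : ContDiff ℝ 2 (rotGen : EuclideanSpace ℝ (Fin 3) → EuclideanSpace ℝ (Fin 3)) := by
    rw [show (rotGen : EuclideanSpace ℝ (Fin 3) → EuclideanSpace ℝ (Fin 3)) = ⇑rotGenL from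
      funext fun v => rfl]
    exact rotGenL.contDiff
  have hw : ContDiff ℝ 2 fun y => angVelQuot u y • rotGen y := hΦ2.smul hJ
  have hb2 : ContDiff ℝ 2 fun y => u y - angVelQuot u y • rotGen y := hu2.sub hw
  have hf := curl_eq_hadamardQuotFst_smul_rotGen
    (Wei2016.isAxisymmetric_sub_angVelQuot_smul_rotGen hax hu2)
    (Wei2016.hasNoSwirl_sub_angVelQuot_smul_rotGen hax hu2) hb2 x
  set f : ℝ := hadamardQuotFst (fun y => curl (fun y => u y - angVelQuot u y • rotGen y) y 1) x
  have hinner : ⟪curl (fun y => u y - angVelQuot u y • rotGen y) x, rotGen x⟫ =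
      (x 0 ^ 2 + x 1 ^ 2) * angVortQuot u x := by
    rw [curl_sub (hud x) ((hw.differentiable (by norm_num)) x), inner_sub_left,
      inner_curl_smul_rotGen_rotGen ((hΦ2.differentiable (by norm_num)) x), sub_zero,
      ← cylRadius_sq, hax.cylRadius_sq_mul_angVortQuot hu3 x, real_inner_comm, inner_rotGen_left]
    rfl
  rw [hf] at hinner ⊢
  rw [inner_smul_left, RCLike.conj_to_real, real_inner_self_eq_norm_sq, norm_rotGen_sq] at hinner
  rcases eq_or_ne (x 0 ^ 2 + x 1 ^ 2) 0 with hρ | hρ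
  · have h0 : x 0 = 0 := by nlinarith [sq_nonneg (x 0), sq_nonneg (x 1)]
    have h1 : x 1 = 0 := by nlinarith [sq_nonneg (x 0), sq_nonneg (x 1)]
    have hJ0 : rotGen x = 0 := by
      ext i; fin_cases i <;> simp [rotGen_eq_sub_single, h0, h1]
    rw [hJ0, smul_zero, smul_zero]
  · have h' : f * (x 0 ^ 2 + x 1 ^ 2) = angVortQuot u x * (x 0 ^ 2 + x 1 ^ 2) := by
      rw [hinner]; ring
    rw [mul_right_cancel₀ hρ h']

/-- **The second elliptic bound for the poloidal part of an axisymmetric field, printed form.**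
For `u ∈ C⁵(ℝ³)` axisymmetric and divergence free on an open `U ⊇ tsupport ζ`, `ζ ∈ C³_c`, and
`b = u − (u_θ/r)J` (`= v̄`):
`∫ ∑ₖ |D∂ₖ(ζb)|²_F ≤ 2 ∫ ‖curl ((ζΓ) J)‖² + (2‖curlCLM‖⁴ + 3) ∫ (‖Dζ‖‖Db‖ + ‖D²ζ‖‖b‖)²`,
`(ζΓ)J = ω_θζ e_θ` being Seregin's `ω_θη³e_θ`. [cite: Seregin2022LocalAxisym, §2 Step 4 (arXiv:2201.00153 p. 7), second elliptic bound] -/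
theorem lintegral_sum_frobeniusNormSq_fderiv_fderiv_smul_poloidal_le'
    {u : EuclideanSpace ℝ (Fin 3) → EuclideanSpace ℝ (Fin 3)} (hax : IsAxisymmetric u)
    (hu : ContDiff ℝ 5 u) (hζ : ContDiff ℝ 3 ζ) (hζc : HasCompactSupport ζ) (hU : IsOpen U)
    (hζU : tsupport ζ ⊆ U) (hdiv : ∀ y ∈ U, VectorCalculus.divergence u y = 0) :
    ∫⁻ x, ENNReal.ofReal (∑ k, frobeniusNormSq (fderiv ℝ (fun y =>
        fderiv ℝ (fun z => ζ z • (u z - angVelQuot u z • rotGen z)) y (EuclideanSpace.single k 1)) x)) ≤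
      2 * (∫⁻ x, ENNReal.ofReal (‖curl (fun y => (ζ y * angVortQuot u y) • rotGen y) x‖ ^ 2)) +
        ENNReal.ofReal (2 * ‖curlCLM‖ ^ 4 + 3) *
          ∫⁻ x, ENNReal.ofReal ((‖fderiv ℝ ζ x‖ *
              ‖fderiv ℝ (fun y => u y - angVelQuot u y • rotGen y) x‖ +
            ‖fderiv ℝ (fderiv ℝ ζ) x‖ * ‖u x - angVelQuot u x • rotGen x‖) ^ 2) := by
  have hJ : ContDiff ℝ 3 (rotGen : EuclideanSpace ℝ (Fin 3) → EuclideanSpace ℝ (Fin 3)) := by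
    rw [show (rotGen : EuclideanSpace ℝ (Fin 3) → EuclideanSpace ℝ (Fin 3)) = ⇑rotGenL from
      funext fun v => rfl]
    exact rotGenL.contDiff
  have hb : ContDiff ℝ 3 fun y => u y - angVelQuot u y • rotGen y :=
    (hu.of_le (by norm_num)).sub ((contDiff_angVelQuot (n := 3) hu).smul hJ)
  have hdivb : ∀ y ∈ U,
      VectorCalculus.divergence (fun x => u x - angVelQuot u x • rotGen x) y = 0 := fun y hy => by
    rw [Wei2016.divergence_sub_angVelQuot_smul_rotGen hax (hu.of_le (by norm_num)) y]
    exact hdiv y hy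
  refine (lintegral_sum_frobeniusNormSq_fderiv_fderiv_smul_le' hζ hζc hU hζU hb.contDiffOn
    hdivb).trans (le_of_eq ?_)
  simp_rw [curl_sub_angVelQuot_smul_rotGen hax (hu.of_le (by norm_num)), smul_smul]

/-- **Second cut-off elliptic bound for the poloidal part, printed form (Seregin 2022, §2 Step 4:
"`‖∇²(η³v̄)‖_{2,𝒞} ≤ c‖|∇η³||∇v̄|‖_{2,𝒞} + c‖|∇²η³||v̄|‖_{2,𝒞} + c‖curl (ω_θη³e_θ)‖_{2,𝒞}`").**
For every `ζ ∈ C³_c(ℝ³)`, every axisymmetric `u ∈ C⁵(ℝ³)` divergence free on an open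
`U ⊇ tsupport ζ`, with `b = u − (u_θ/r)J` its smooth poloidal part (`angVelQuot`, `rotGen`) and
`Γ = angVortQuot u = ω_θ/r`:
`∫ ∑ₖ |D∂ₖ(ζb)|²_F ≤ 2 ∫ ‖curl ((ζΓ)J)‖² + (2‖curlCLM‖⁴ + 3) ∫ (‖Dζ‖‖Db‖ + ‖D²ζ‖‖b‖)²`.
Registered sub-goal toward `stub_sereginLogSwirlOrigin`. [cite: Seregin2022LocalAxisym, §2 Step 4 (arXiv:2201.00153 p. 7), second elliptic bound] -/
theorem lintegral_sum_frobeniusNormSq_fderiv_fderiv_smul_poloidal_le : ∀ (ζ : EuclideanSpace ℝ (Fin 3) → ℝ) (u : EuclideanSpace ℝ (Fin 3) → EuclideanSpace ℝ (Fin 3)) (U : Set (EuclideanSpace ℝ (Fin 3))), IsAxisymmetric u → ContDiff ℝ 5 u → ContDiff ℝ 3 ζ → HasCompactSupport ζ → IsOpen U → tsupport ζ ⊆ U → (∀ y ∈ U, VectorCalculus.divergence u y = 0) → ∫⁻ x, ENNReal.ofReal (∑ k, frobeniusNormSq (fderiv ℝ (fun y => fderiv ℝ (fun z => ζ z • (u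 z - angVelQuot u z • rotGen z)) y (EuclideanSpace.single k 1)) x)) ≤ 2 * (∫⁻ x, ENNReal.ofReal (‖curl (fun y => (ζ y * angVortQuot u y) • rotGen y) x‖ ^ 2)) + ENNReal.ofReal (2 * ‖curlCLM‖ ^ 4 + 3) * ∫⁻ x, ENNReal.ofReal ((‖fderiv ℝ ζ x‖ * ‖fderiv ℝ (fun y => u y - angVelQuot u y • rotGen y) x‖ + ‖fderiv ℝ (fderiv ℝ ζ) x‖ * ‖u x - angVelQuot u x • rotGen x‖) ^ 2) :=
  fun _ _ _ hax hu hζ hζc hU hζU hdiv =>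
    lintegral_sum_frobeniusNormSq_fderiv_fderiv_smul_poloidal_le' hax hu hζ hζc hU hζU hdiv

/-! ### Seregin's `curl (ω_θζe_θ) = −(ω_θζ),₃ e_r + ((ω_θζ),_r + Γζ) e₃` in Cartesian form -/

/-- `(curl (g J))₂ = 2g + x₀∂₀g + x₁∂₁g` wherever `g` is differentiable (`J = rotGen`; the tree
has the components `(curl (gJ))₀ = −x₀∂₂g`, `(curl (gJ))₁ = −x₁∂₂g`,
`curl_smul_rotGenL_apply_zero/one`). [folklore] -/
theorem curl_smul_rotGen_apply_two {g : EuclideanSpace ℝ (Fin 3) → ℝ} {x : EuclideanSpace ℝ (Fin 3)}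
    (hg : DifferentiableAt ℝ g x) :
    curl (fun y => g y • rotGen y) x 2 = 2 * g x + x 0 * fderiv ℝ g x (EuclideanSpace.single 0 1) +
      x 1 * fderiv ℝ g x (EuclideanSpace.single 1 1) := by
  -- adapted from `Literature.Analysis.FluidPDE.curl_smul_rotGenL_apply_zero`
  change curl (fun y => g y • rotGenL y) x 2 = _
  have h : curl (fun y => g y • rotGenL y) x 2 =
      fderiv ℝ (fun y => g y • rotGenL y) x (EuclideanSpace.single 0 1) 1 -
        fderiv ℝ (fun y => g y • rotGenL y) x (EuclideanSpace.single 1 1) 0 := by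
    simp [curl]
  rw [h, fderiv_smul_rotGenL_apply hg, fderiv_smul_rotGenL_apply hg]
  simp [rotGenL_apply, rotGen]
  ring

/-- **Seregin's formula `curl (ω_θζe_θ) = −(ω_θζ),₃ e_r + ((ω_θζ),_r + Γζ) e₃` as a norm identity.**
With `ω_θζ e_θ = g J`, `g = ζΓ` (`ω_θ = rΓ`, `e_θ = J/r`): wherever `g` is differentiable,
`‖curl (g J)‖² = (x₀² + x₁²)(∂₂g)² + (2g + x₀∂₀g + x₁∂₁g)²` (`= r²(∂₃g)² + (r∂ᵣg + 2g)²`, and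
`r∂₃g = (ω_θζ),₃`, `r∂ᵣg + 2g = (ω_θζ),ᵣ + Γζ`). [cite: Seregin2022LocalAxisym, §2 Step 4 (arXiv:2201.00153 p. 7), display after the second bound] -/
theorem norm_curl_smul_rotGen_sq {g : EuclideanSpace ℝ (Fin 3) → ℝ} {x : EuclideanSpace ℝ (Fin 3)}
    (hg : DifferentiableAt ℝ g x) :
    ‖curl (fun y => g y • rotGen y) x‖ ^ 2 =
      (x 0 ^ 2 + x 1 ^ 2) * fderiv ℝ g x (EuclideanSpace.single 2 1) ^ 2 +
        (2 * g x + x 0 * fderiv ℝ g x (EuclideanSpace.single 0 1) +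
          x 1 * fderiv ℝ g x (EuclideanSpace.single 1 1)) ^ 2 := by
  have h0 : curl (fun y => g y • rotGen y) x 0 = -(x 0 * fderiv ℝ g x (EuclideanSpace.single 2 1)) :=
    curl_smul_rotGenL_apply_zero hg
  have h1 : curl (fun y => g y • rotGen y) x 1 = -(x 1 * fderiv ℝ g x (EuclideanSpace.single 2 1)) :=
    curl_smul_rotGenL_apply_one hg
  rw [EuclideanSpace.norm_sq_eq]
  simp only [Fin.sum_univ_three, Real.norm_eq_abs, sq_abs, h0, h1, curl_smul_rotGen_apply_two hg]
  ring

/-- **`‖curl ((ζΓ)J)‖² ≤ 8(ζΓ)² + 2r²|∇(ζΓ)|²`**: wherever `g` is differentiable,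
`‖curl (g J)‖² ≤ 8g² + 2(x₀² + x₁²) ∑ᵢ (∂ᵢg)²` (Cauchy–Schwarz in the norm identity), so that the
right-hand side `‖curl (ω_θη³e_θ)‖_{2,𝒞}` of Seregin's second bound is controlled on the unit
cylinder by `‖η³Γ‖₂ + ‖∇(η³Γ)‖₂`, the quantities bounded in Step 3. [cite: Seregin2022LocalAxisym, §2 Step 4 (arXiv:2201.00153 p. 7)] -/
theorem norm_curl_smul_rotGen_sq_le {g : EuclideanSpace ℝ (Fin 3) → ℝ} {x : EuclideanSpace ℝ (Fin 3)}
    (hg : DifferentiableAt ℝ g x) :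
    ‖curl (fun y => g y • rotGen y) x‖ ^ 2 ≤
      8 * g x ^ 2 + 2 * (x 0 ^ 2 + x 1 ^ 2) * ∑ i, fderiv ℝ g x (EuclideanSpace.single i 1) ^ 2 := by
  rw [norm_curl_smul_rotGen_sq hg]
  simp only [Fin.sum_univ_three]
  set a := fderiv ℝ g x (EuclideanSpace.single 0 1)
  set b := fderiv ℝ g x (EuclideanSpace.single 1 1)
  set c := fderiv ℝ g x (EuclideanSpace.single 2 1)
  nlinarith [sq_nonneg (2 * g x - (x 0 * a + x 1 * b)), sq_nonneg (x 0 * b - x 1 * a),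
    sq_nonneg c, sq_nonneg (x 0), sq_nonneg (x 1), mul_self_nonneg (x 0 * c),
    mul_self_nonneg (x 1 * c)]

end Poloidal

end Summit.NavierStokesRegularity.NavierStokesRegularity.Theorems.AxisymmetricKatoGlobal.EulerScaling

end
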